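import Literature.Geometry.Riemannian.HamiltonCurvatureRatio
import Literature.Geometry.Riemannian.ChangGurskyYangRegularity
import Literature.Geometry.Lorentzian.MetricNormSqBounds
import HarnessLib

/-!
# Hamilton 1982, Thm. 15.1 with a localised Ricci hypothesis; `Rc ≥ (R/m − |E|) g`
(helper of stub `stub_curvatureRatio` of line `margerin-cone-hamilton-rails`, crux
`EntropyRung.ChangGurskyYang`, item stmt-SmoothPoincare4-10834)

Two fact-free ingredients of Step 4.B2 (`stub_curvatureRatio` = Hamilton 1982, Thm. 15.1,
"`R_max/R_min → 1` as `t → T`") of the line, kept apart from the flow argument of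
`EntropyRungChangGurskyYangStubCurvatureRatio.lean`:

* `one_sub_mul_le_of_ricci_ge_local` — the GEOMETRIC STEP of Thm. 15.1, verbatim the tree's
  `one_sub_mul_le_of_ricci_ge_of_mfderiv_le` (`Literature/…/HamiltonCurvatureRatio.lean`: gradient
  bound `|dR| ≤ η² R_max^{3/2}`, `Rc ≥ ε R g`, Hopf–Rinow and the local Myers theorem
  `length_mul_sqrt_le_pi_of_isMinimizingUpTo` = Hamilton's Thm. 15.2), except that the Ricci
  hypothesis is only assumed at the points with `R ≥ (1 − η) R_max` — the printed proof (p. 299)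
  uses it only along the initial segment of length `s = 1/(η √R_max)` of a geodesic from the
  maximum point, where `R ≥ (1 − η) R_max` by the gradient bound (`abs_sub_le_mul_of_mfderiv_le`).
  Along the Ricci flow `Rc ≥ ε R g` is only known where `R` is large, whence the need for the
  localised form; `helper_curvatureRatio_localMyers` (registered) is its specialisation to closed
  connected 4-manifolds (`dim − 1 = 3`, differential as `mvfderiv`).
* `normSq_tracelessRicci_eq`, `sub_sqrt_mul_val_le_ricci` — `|E|²` (`tracelessRicciNormSq`) is the
  metric square norm of the bilinear form `E = Rc − (R/m) g` (`tracelessRicci`), so Cauchy–Schwarz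
  (`abs_apply_le_sqrt_normSq_mul`) gives `|E(w, w)| ≤ |E| g(w, w)` and
  `Rc(w, w) ≥ (R/m − |E|) g(w, w)`.

No definition, no named fact is introduced.

## References

* R. S. Hamilton, *Three-manifolds with positive Ricci curvature*, J. Differential Geom. 17 (1982)
  255–306, §15, Thm. 15.1 and Thm. 15.2 (p. 299). [Hamilton1982]
* S.-Y. A. Chang, M. J. Gursky, P. C. Yang, *A conformally invariant sphere theorem in four
  dimensions*, Publ. Math. IHÉS 98 (2003) 105–143, (0.1)–(0.2). [ChangGurskyYang2003]
* B. O'Neill, *Semi-Riemannian geometry* (1983), Ch. 3, pp. 60–61. [ONeill1983]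
-/

noncomputable section

-- every `Summit.SmoothPoincare4.SmoothPoincare4.…` name repeats the summit = sub-problem segment (D-0017 layout)
set_option linter.dupNamespace false

open Set Function Filter Module
open scoped Manifold ContDiff Topology

namespace Summit.SmoothPoincare4.SmoothPoincare4.Theorems.MargerinRails

open Literature.Geometry.Riemannian
open Literature.Geometry.Lorentzian Literature.Geometry.Lorentzian.PseudoRiemannianMetric

/-! ## Hamilton 1982, Thm. 15.1, geometric step, with the Ricci hypothesis localised -/

section LocalRatio

variable {E : Type*} [NormedAddCommGroup E] [NormedSpace ℝ E] [FiniteDimensional ℝ E]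
  [CompleteSpace E] {M : Type*} [TopologicalSpace M] [ChartedSpace E M] [IsManifold 𝓘(ℝ, E) ∞ M]
  [T2Space M] [CompactSpace M] [ConnectedSpace M]
  (g : PseudoRiemannianMetric 𝓘(ℝ, E) ∞ E (TangentSpace 𝓘(ℝ, E) : M → Type _)) [g.HasLeviCivita]

/-- **Hamilton 1982, Thm. 15.1 (geometric step), Ricci hypothesis localised to `{R ≥ (1-η)R_max}`.**
On a compact connected boundaryless manifold of dimension `m ≥ 2` with a smooth Riemannian metric
`g`, let `R` be `C¹` with `R(x) > 0`, `|dR_y(w)| ≤ η² R(x)^{3/2} |w|_g`, and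
`Rc_y(w, w) ≥ ε R(y) g_y(w, w)` AT THE POINTS `y` WITH `R(y) ≥ (1-η) R(x)`; if `0 < η < 1`, `ε > 0`
and `π²(m-1)η² < ε(1-η)`, then `R ≥ (1-η) R(x)` everywhere. The printed proof (p. 299) verbatim —
it only invokes the Ricci bound along the initial segment of length `s = 1/(η√R(x))` of a unit-speed
geodesic from `x`, where `R ≥ R(x) − η² R(x)^{3/2} s = (1-η) R(x)` by the gradient bound
(`abs_sub_le_mul_of_mfderiv_le`); Hopf–Rinow (`exists_isMinimizingUpTo_of_isGeodesicallyComplete`)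
and Myers (`length_mul_sqrt_le_pi_of_isMinimizingUpTo`, Hamilton's Thm. 15.2) as in the tree's
`one_sub_mul_le_of_ricci_ge_of_mfderiv_le`. [cite: Hamilton1982, §15, Thm. 15.1] -/
theorem one_sub_mul_le_of_ricci_ge_local (hg : g.IsRiemannian)
    (hdim : 2 ≤ Module.finrank ℝ E) {R : M → ℝ} (hR : ∀ y, MDifferentiableAt 𝓘(ℝ, E) 𝓘(ℝ, ℝ) R y)
    {x : M} (hpos : 0 < R x) {η ε : ℝ} (hη : 0 < η) (hη1 : η < 1)
    (hε : 0 < ε)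
    (hsmall : Real.pi ^ 2 * ((Module.finrank ℝ E : ℝ) - 1) * η ^ 2 < ε * (1 - η))
    (hgrad : ∀ (y : M) (w : TangentSpace 𝓘(ℝ, E) y),
      |(show ℝ from mfderiv 𝓘(ℝ, E) 𝓘(ℝ, ℝ) R y w)| ≤
        η ^ 2 * (R x * Real.sqrt (R x)) * Real.sqrt (g.val y w w))
    (hRic : ∀ (y : M) (w : TangentSpace 𝓘(ℝ, E) y), (1 - η) * R x ≤ R y →
      ε * R y * g.val y w w ≤ g.leviCivita.ricci y w w)
    (y : M) : (1 - η) * R x ≤ R y := by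
  -- adapted from Literature/Geometry/Riemannian/HamiltonCurvatureRatio.lean
  -- (`one_sub_mul_le_of_ricci_ge_of_mfderiv_le`), with `hRic` used only where `R ≥ (1-η) R x`
  have hLC := PseudoRiemannianMetric.isLeviCivita_leviCivita_holds (g := g)
  have hk1 : ((1 : ℕ∞) : ℕ∞ω) + 1 ≤ ∞ := by
    rw [show ((1 : ℕ∞) : ℕ∞ω) + 1 = 2 by norm_num]
    exact WithTop.coe_le_coe.2 le_top
  haveI : CovariantDerivative.ContMDiffCovariantDerivative g.leviCivita 1 :=
    ⟨g.isLocallyContMDiff_leviCivita_holds 1 hk1 univ isOpen_univ⟩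
  haveI : CovariantDerivative.ContMDiffCovariantDerivative g.leviCivita ∞ :=
    ⟨g.isLocallyContMDiff_leviCivita_holds ⊤ (le_of_eq rfl) univ isOpen_univ⟩
  have hc : IsGeodesicallyComplete g.leviCivita := hopfRinow_compact_geodesicallyComplete le_rfl hg
  -- the constants
  set Rm := R x with hRm
  set m1 : ℝ := (Module.finrank ℝ E : ℝ) - 1 with hm1
  have hm1pos : 0 < m1 := by
    have : (2 : ℝ) ≤ (Module.finrank ℝ E : ℝ) := by exact_mod_cast hdim
    rw [hm1]; linarith
  have h1η : 0 < 1 - η := by linarith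
  set sR := Real.sqrt Rm with hsR
  have hsR0 : 0 < sR := Real.sqrt_pos.2 hpos
  have hsq : sR ^ 2 = Rm := Real.sq_sqrt hpos.le
  set A := η ^ 2 * (Rm * sR) with hA
  have hA0 : 0 ≤ A := by positivity
  set s := 1 / (η * sR) with hs
  have hs0 : 0 < s := by positivity
  have hAs : A * s = η * Rm := by
    rw [hA, hs]
    field_simp
  -- the estimate along unit-speed geodesics from `x`
  have hlow : ∀ (u : TangentSpace 𝓘(ℝ, E) x), g.val x u u = 1 → ∀ t, 0 ≤ t →
      Rm - A * t ≤ R (maximalGeodesic g.leviCivita x u t) := by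
    intro u hu t ht
    have h := abs_sub_le_mul_of_mfderiv_le g hc hR hgrad x u hu ht
    rw [abs_le] at h
    linarith [h.1]
  -- a minimizing geodesic from `x` to `y`
  obtain ⟨v, hmin, hyv⟩ := exists_isMinimizingUpTo_of_isGeodesicallyComplete g le_rfl hg hc x y
  have hvv0 : 0 ≤ g.val x v v := by
    by_cases hv : v = 0
    · simp [hv]
    · exact (hg x v hv).le
  set ℓ := Real.sqrt (g.val x v v) with hℓ
  rcases (show 0 ≤ ℓ from Real.sqrt_nonneg _).eq_or_lt with hℓ0 | hℓpos
  · -- `y = x`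
    have hv0 : v = 0 := by
      by_contra hv
      have h1 : 0 < g.val x v v := hg x v hv
      have h2 : 0 < ℓ := Real.sqrt_pos.2 h1
      linarith
    have hyx : y = x := by
      rw [← hyv, hv0]
      exact riemannianExpMap_zero g x
    rw [hyx]
    nlinarith
  -- unit-speed reparametrisation `u = ℓ⁻¹ v`: minimizing up to `ℓ`, ending at `y`
  have hvv : g.val x v v = ℓ ^ 2 := (Real.sq_sqrt hvv0).symm
  set u : TangentSpace 𝓘(ℝ, E) x := ℓ⁻¹ • v with hu'
  have hu : g.val x u u = 1 := by
    have h1 : g.val x u u = ℓ⁻¹ * ℓ⁻¹ * g.val x v v := by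
      rw [hu']
      simp only [map_smul, FunLike.coe_smul, Pi.smul_apply, smul_eq_mul]
      ring
    rw [h1, hvv]
    field_simp
  have hminu : IsMinimizingUpTo g hg x u ℓ := by
    rw [hu', isMinimizingUpTo_smul_iff hg hc x v (inv_pos.2 hℓpos), inv_mul_cancel₀ hℓpos.ne']
    exact hmin
  have hγℓ : maximalGeodesic g.leviCivita x u ℓ = y := by
    rw [hu', maximalGeodesic_smul hc x v ℓ⁻¹ ℓ, inv_mul_cancel₀ hℓpos.ne', ← hyv]
    exact (expMap_eq_maximalGeodesic hc x v).symm
  -- the speed of `γ_u`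
  obtain ⟨-, hgeo, hγ0, hγu⟩ := maximalGeodesic_of_isGeodesicallyComplete hc x u
  have hspeed : ∀ t, g.val (maximalGeodesic g.leviCivita x u t)
      (velocity 𝓘(ℝ, E) (maximalGeodesic g.leviCivita x u) t)
      (velocity 𝓘(ℝ, E) (maximalGeodesic g.leviCivita x u) t) = 1 := by
    intro t
    rw [g.val_velocity_eq_of_isGeodesicOn_of_isCompatible hLC.2 isOpen_univ Set.ordConnected_univ
      hgeo (mem_univ t) (mem_univ 0), hγu]
    have : maximalGeodesic g.leviCivita x u 0 = x := hγ0
    rw [this]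
    exact hu
  -- the length is at most `s`, by Myers
  have hℓs : ℓ ≤ s := by
    by_contra hlt
    push Not at hlt
    have hmins : IsMinimizingUpTo g hg x u s := hminu.mono hc hs0.le hlt.le
    set k := ε * (1 - η) * Rm / m1 with hk
    have hk0 : 0 < k := by positivity
    have hRic' : ∀ t ∈ Ioo 0 s, ((Module.finrank ℝ E : ℝ) - 1) * k ≤
        g.leviCivita.ricci (maximalGeodesic g.leviCivita x u t)
          (velocity 𝓘(ℝ, E) (maximalGeodesic g.leviCivita x u) t)
          (velocity 𝓘(ℝ, E) (maximalGeodesic g.leviCivita x u) t) := by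
      intro t ht
      have h1 : (1 - η) * Rm ≤ R (maximalGeodesic g.leviCivita x u t) := by
        have h2 := hlow u hu t ht.1.le
        have h3 : A * t ≤ A * s := mul_le_mul_of_nonneg_left ht.2.le hA0
        rw [hAs] at h3
        linarith
      -- the localised Ricci bound applies at this point of the initial segment
      have h2 := hRic _ (velocity 𝓘(ℝ, E) (maximalGeodesic g.leviCivita x u) t) h1
      rw [hspeed t, mul_one] at h2
      have h4 : m1 * k = ε * ((1 - η) * Rm) := by
        rw [hk]
        field_simp
      calc ((Module.finrank ℝ E : ℝ) - 1) * k = m1 * k := by rw [hm1]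
        _ = ε * ((1 - η) * Rm) := h4
        _ ≤ ε * R (maximalGeodesic g.leviCivita x u t) := mul_le_mul_of_nonneg_left h1 hε.le
        _ ≤ _ := h2
    have hmy := length_mul_sqrt_le_pi_of_isMinimizingUpTo g hg hdim hc x u hu hk0 hs0 hmins hRic'
    -- but `s √k > π`
    have hsk : (s * Real.sqrt k) ^ 2 = ε * (1 - η) / (η ^ 2 * m1) := by
      rw [mul_pow, Real.sq_sqrt hk0.le, hs, hk, div_pow, one_pow, mul_pow, hsq]
      field_simp
    have hπ : Real.pi ^ 2 < (s * Real.sqrt k) ^ 2 := by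
      rw [hsk, lt_div_iff₀ (by positivity)]
      calc Real.pi ^ 2 * (η ^ 2 * m1) = Real.pi ^ 2 * m1 * η ^ 2 := by ring
        _ < ε * (1 - η) := hsmall
    have hcontra : Real.pi < s * Real.sqrt k := lt_of_pow_lt_pow_left₀ 2 (by positivity) hπ
    linarith
  -- conclusion along `γ_u|[0, ℓ]`
  have h1 := hlow u hu ℓ hℓpos.le
  have h2 : A * ℓ ≤ A * s := mul_le_mul_of_nonneg_left hℓs hA0
  rw [hAs] at h2
  rw [← hγℓ]
  linarith

end LocalRatio

/-! ## `Rc ≥ (R/4 − |E|) g`: the traceless Ricci tensor against the metric square norm -/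

section RicciLower

variable {E : Type*} [NormedAddCommGroup E] [NormedSpace ℝ E] {H : Type*} [TopologicalSpace H]
  {I : ModelWithCorners ℝ E H} {M : Type*} [TopologicalSpace M] [ChartedSpace H M]
  [IsManifold I ∞ M]
  (g : PseudoRiemannianMetric I ∞ E (TangentSpace I : M → Type _))
  [FiniteDimensional ℝ E] [g.HasLeviCivita]

/-- **`|E|²_g(x)` is the metric square norm of the bilinear form `E = Ric − (S/m) g`**
(`normSq_eq_sum_sq` in an orthonormal basis versus the frame value
`tracelessRicciNormSq_eq_tracelessRicciNormSqFrame`, `tracelessRicciFrame_eq_tracelessRicci`), for a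
Riemannian metric. [cite: ChangGurskyYang2003, (0.2)] -/
theorem normSq_tracelessRicci_eq (hg : g.IsRiemannian) (x : M) :
    g.normSq x (g.tracelessRicci x) = g.tracelessRicciNormSq x := by
  classical
  obtain ⟨b, hb⟩ := g.exists_basis_isOrthonormalFrame (x := x) (fun v hv ↦ hg x v hv) rfl
  have hι : Fintype.card (Fin (finrank ℝ E)) = finrank ℝ E := Fintype.card_fin _
  have hO : (g.toBilinForm x).IsOrthoᵢ b := fun i j hij ↦ hb.2 i j hij
  have hc : ∀ i, g.val x (b i) (b i) ≠ 0 := fun i ↦ by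
    rw [hb.1 i]
    exact one_ne_zero
  rw [g.normSq_eq_sum_sq x b hO hc, g.tracelessRicciNormSq_eq_tracelessRicciNormSqFrame hb,
    tracelessRicciNormSqFrame, Finset.sum_comm]
  simp only [hb.1, mul_one, div_one, g.tracelessRicciFrame_eq_tracelessRicci hb hι]

/-- **`Rc(w, w) ≥ (S/m − |E|) g(w, w)`** for a Riemannian metric (`m = dim`): `Rc = E + (S/m) g`
and `|E(w, w)| ≤ √(|E|²) g(w, w)` by Cauchy–Schwarz for the metric square norm
(`abs_apply_le_sqrt_normSq_mul`, `normSq_tracelessRicci_eq`). [cite: Hamilton1982, §15, Thm. 15.1 (proof)] -/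
theorem sub_sqrt_mul_val_le_ricci (hg : g.IsRiemannian) (x : M) (w : TangentSpace I x) :
    (g.scalarCurvature x / finrank ℝ E - Real.sqrt (g.tracelessRicciNormSq x)) * g.val x w w ≤
      g.ricci x w w := by
  have h := g.abs_apply_le_sqrt_normSq_mul x hg (g.tracelessRicci x) w
  rw [normSq_tracelessRicci_eq g hg, tracelessRicci_apply, abs_le] at h
  rw [sub_mul]
  linarith [h.1]

end RicciLower

/-! ## The registered helper: closed connected 4-manifolds -/

/-- **Hamilton 1982, Thm. 15.1 (geometric step, localised Ricci hypothesis) on a closed connected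
4-manifold** — `one_sub_mul_le_of_ricci_ge_local` with `dim − 1 = 3` and the differential written as
`mvfderiv`: if `R` is `C¹`, `R(x) > 0`, `|dR_y(w)| ≤ η² R(x)^{3/2} |w|_g`, `Rc ≥ ε R g` at the points
with `R ≥ (1 − η) R(x)`, `0 < η < 1`, `0 < ε`, `3π²η² < ε(1 − η)`, then `R ≥ (1 − η) R(x)` everywhere.
Registered helper stub of item stmt-SmoothPoincare4-10834. [cite: Hamilton1982, §15, Thm. 15.1] -/
theorem helper_curvatureRatio_localMyers : ∀ (M : Type) [TopologicalSpace M] [T2Space M] [ChartedSpace (EuclideanSpace ℝ (Fin 4)) M] [IsManifold (𝓡 4) ∞ M] [CompactSpace M] [ConnectedSpace M] (g : PseudoRiemannianMetric (𝓡 4) ∞ (EuclideanSpace ℝ (Fin 4)) (TangentSpace (𝓡 4) : M → Type _)) [g.HasLeviCivita], g.IsRiemannian → ∀ (R : M → ℝ) (x : M) (η ε : ℝ), (∀ y : M, MDifferentiableAt (𝓡 4) 𝓘(ℝ, ℝ) R y) → 0 < R x → 0 < η → η < 1 → 0 < ε → Real.pi ^ 2 * 3 * η ^ 2 < ε * (1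 - η) → (∀ (y : M) (w : TangentSpace (𝓡 4) y), |mvfderiv (𝓡 4) R y w| ≤ η ^ 2 * (R x * Real.sqrt (R x)) * Real.sqrt (g.val y w w)) → (∀ (y : M) (w : TangentSpace (𝓡 4) y), (1 - η) * R x ≤ R y → ε * R y * g.val y w w ≤ g.ricci y w w) → ∀ y : M, (1 - η) * R x ≤ R y := by
  intro M _ _ _ _ _ _ g _ hg R x η ε hR hpos hη hη1 hε hsmall hgrad hRic y
  have h4 : finrank ℝ (EuclideanSpace ℝ (Fin 4)) = 4 := finrank_euclideanSpace_fin
  refine one_sub_mul_le_of_ricci_ge_local g hg (by rw [h4]; norm_num) hR hpos hη hη1 hε ?_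
    (fun y w ↦ hgrad y w) (fun y w h ↦ hRic y w h) y
  rw [h4]
  push_cast
  linarith

end Summit.SmoothPoincare4.SmoothPoincare4.Theorems.MargerinRails

end
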